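import Literature.MathematicalPhysics.QuantumLattice.HubbardNNNHoppingWindowCertificate
import Literature.MathematicalPhysics.QuantumLattice.HubbardWindowCertificateD4
import HarnessLib

/-!
# Window certificates for the `t–t'` Hubbard model with POINT-GROUP (`D₄`) reductions

Family `hubbard` (topic `MathematicalPhysics/QuantumLattice`). The `D₄` companion of
`HubbardNNNHoppingWindowCertificate` (symmetry family: lattice translations `τ_v`) for the published
`t–t'` Hubbard model `H = -t Σ_{⟨xy⟩σ} c†c - t' Σ_{⟨⟨xy⟩⟩σ} c†c + U Σ n↑n↓` (Xu et al. (2024) eq. (1),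
LeBlanc et al. (2015) eq. (1)), exactly as `HubbardWindowCertificateD4` is the `D₄` companion of
`HubbardWindowCertificate` at `t' = 0`. Han's two-dimensional bootstrap identifies a monomial with
its images under the translations AND the point group of the square lattice (arXiv:2006.06002 §3,
`F[U⁻¹ O U] = F[O]`, `U ∈ {T_(1,0), T_(0,1), Π, R}`); so do the reduce-mode certificates of the
bundle papers/HubbardSuperconductivity/hubbard-ladder/ (`hypotheses.reduce.point_group`, kept at
`t' ≠ 0` because the `t–t'` Hamiltonian of `ℤ²` is `D₄`-invariant about every site: the diagonal bond
set `{x, x + e₁ ± e₂}` is stable under the rotation by `π/2` and the axis reflection).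

Content (everything PROVED; no definitions):
* `torusDiagGraph_adj_d4Site_iff`, `fermionTorusDiagGraph_adj_d4SitePerm` — `D₄` acts by automorphisms
  of the DIAGONAL bond graph of `(ℤ/Lℤ)²`;
* `relabel_d4Perm_hubbardTorusTT'`, `fockD4_commute_hubbardTorusTT'`, `d4Affine_mul_hubbardTorusTT'` —
  the `D₄` / affine-`D₄` Fock unitaries commute with `hubbardTorusTT' L t t' U`;
* `groundEnergy_hubbardTorusTT'_div_ge_of_window_certificate_d4` — the window theorem with affine
  `D₄` identifications `Γ(incl)(Γ(d4Emb γₗ wₗ) Yₗ) − Γ(incl) Yₗ` (translations: `γₗ = 1`), with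
  EXACTLY the hypothesis list of `groundEnergyAt_div_ge_of_window_certificate_d4` except that the
  interaction is `hubbardTTPrimeFermionInteraction t t' U` and the nearest-neighbour closure
  `hclosed` is replaced by the king-move thickening `h8 : thicken Λ 1 ⊆ Λ'` (range of the diagonal
  bond, as in the `t–t'` translation theorem);
* `energyDensityTT'_ge_of_window_certificate_d4` — its thermodynamic-limit corollary
  `c − Σₖ ‖aₖ‖ ≤ energyDensityTT' t t' U n`.

Proof = the `t–t'` translation proof (`HubbardNNNHoppingWindowCertificate`) with the symmetry family
of `HubbardWindowCertificateD4` (`fermionEmbed_toTorusEmb_d4_sub`, `d4Affine_*`), the state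
invariance being supplied by `d4Affine_mul_hubbardTorusTT'`.

## References
* X. Han, *Quantum many-body bootstrap*, arXiv:2006.06002 (2020), §2 eq. (2), §3 (symmetries
  `T_(1,0), T_(0,1), Π, R` of the square lattice). [cite: Han2020Bootstrap, §3]
* H. Xu et al., Science 384 (2024) eadh7691, eq. (1) (the `t–t'` Hubbard model). [cite: XuEtAl2024, eq. (1)]
* D. J. Scalapino, Phys. Rep. 250 (1995) 329, §2 (square-lattice point group `C₄ᵥ ≅ D₄`).
  [cite: Scalapino1995, §2]
* O. Bratteli, D. W. Robinson, *Operator Algebras and Quantum Statistical Mechanics II*, 2nd ed.,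
  §5.2.2, Thm. 5.2.5 (Bogoliubov automorphisms of one-particle bijections). [cite: BratteliRobinsonII1997, §5.2.2]
-/

noncomputable section

namespace Literature.MathematicalPhysics.QuantumLattice

open Matrix Finset HubbardWave0 Literature.Probability.LatticeModels
open Literature.MathematicalPhysics.QuantumManyBody.StateRelaxation
open scoped ComplexOrder BigOperators

/-! ### `D₄` acts by automorphisms of the diagonal bond graph -/

section PointGroup

variable {L : ℕ}

/-- `rot (e₁ + e₂) = -(e₁ - e₂)` on `(ℤ/Lℤ)²`. [folklore] -/
private theorem rotSite_torusDiagJump_zero : rotSite (torusDiagJump L 0) = -torusDiagJump L 1 := by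
  funext i; fin_cases i <;> simp [rotSite, torusDiagJump]

/-- `rot (e₁ - e₂) = e₁ + e₂`. [folklore] -/
private theorem rotSite_torusDiagJump_one : rotSite (torusDiagJump L 1) = torusDiagJump L 0 := by
  funext i; fin_cases i <;> simp [rotSite, torusDiagJump]

/-- `refl (e₁ + e₂) = e₁ - e₂`. [folklore] -/
private theorem reflSite_torusDiagJump_zero : reflSite (torusDiagJump L 0) = torusDiagJump L 1 := by
  funext i; fin_cases i <;> simp [reflSite, torusDiagJump]

/-- `refl (e₁ - e₂) = e₁ + e₂`. [folklore] -/
private theorem reflSite_torusDiagJump_one : reflSite (torusDiagJump L 1) = torusDiagJump L 0 := by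
  funext i; fin_cases i <;> simp [reflSite, torusDiagJump]

/-- The rotation by `π/2` preserves diagonal adjacency on `(ℤ/Lℤ)²` (the diagonal step set
`{±(e₁+e₂), ±(e₁-e₂)}` is rotation-stable). [cite: Scalapino1995, §2] -/
theorem torusDiagGraph_adj_rotSite {x y : TorusSite 2 L} (h : (torusDiagGraph L).Adj x y) :
    (torusDiagGraph L).Adj (rotSite x) (rotSite y) := by
  rw [torusDiagGraph_adj_iff] at h ⊢
  obtain ⟨hne, h⟩ := h
  refine ⟨fun h' => hne (rotSite_injective h'), ?_⟩
  simp only [Fin.exists_fin_two] at h ⊢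
  rcases h with (rfl | rfl) | (rfl | rfl)
  · exact Or.inr (Or.inr (by rw [rotSite_add, rotSite_torusDiagJump_zero, neg_add_cancel_right]))
  · exact Or.inl (Or.inl (by rw [rotSite_add, rotSite_torusDiagJump_one]))
  · exact Or.inl (Or.inr (by rw [rotSite_add, rotSite_torusDiagJump_zero, neg_add_cancel_right]))
  · exact Or.inr (Or.inl (by rw [rotSite_add, rotSite_torusDiagJump_one]))

/-- The axis reflection preserves diagonal adjacency on `(ℤ/Lℤ)²`. [cite: Scalapino1995, §2] -/
theorem torusDiagGraph_adj_reflSite {x y : TorusSite 2 L} (h : (torusDiagGraph L).Adj x y) :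
    (torusDiagGraph L).Adj (reflSite x) (reflSite y) := by
  rw [torusDiagGraph_adj_iff] at h ⊢
  obtain ⟨hne, h⟩ := h
  refine ⟨fun h' => hne (reflSite_injective h'), ?_⟩
  simp only [Fin.exists_fin_two] at h ⊢
  rcases h with (rfl | rfl) | (rfl | rfl)
  · exact Or.inl (Or.inr (by rw [reflSite_add, reflSite_torusDiagJump_zero]))
  · exact Or.inl (Or.inl (by rw [reflSite_add, reflSite_torusDiagJump_one]))
  · exact Or.inr (Or.inr (by rw [reflSite_add, reflSite_torusDiagJump_zero]))
  · exact Or.inr (Or.inl (by rw [reflSite_add, reflSite_torusDiagJump_one]))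

/-- Every element of `D₄` preserves diagonal adjacency on the torus. [cite: Scalapino1995, §2] -/
theorem torusDiagGraph_adj_d4Site (γ : DihedralGroup 4) {x y : TorusSite 2 L}
    (h : (torusDiagGraph L).Adj x y) : (torusDiagGraph L).Adj (d4Site γ x) (d4Site γ y) := by
  have hrot : ∀ n : ℕ, ∀ {x y : TorusSite 2 L}, (torusDiagGraph L).Adj x y →
      (torusDiagGraph L).Adj (rotSite^[n] x) (rotSite^[n] y) := by
    intro n
    induction n with
    | zero => intro x y h; exact h
    | succ n ih =>
      intro x y h
      rw [Function.iterate_succ_apply', Function.iterate_succ_apply']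
      exact torusDiagGraph_adj_rotSite (ih h)
  cases γ with
  | r i => exact hrot i.val h
  | sr i => exact torusDiagGraph_adj_reflSite (hrot i.val h)

/-- **`D₄` acts by graph automorphisms of the diagonal bond graph of `(ℤ/Lℤ)²`** (the `t'` bonds
`{x, x + e₁ ± e₂}` of the `t–t'` model). [cite: Scalapino1995, §2] -/
theorem torusDiagGraph_adj_d4Site_iff (γ : DihedralGroup 4) (x y : TorusSite 2 L) :
    (torusDiagGraph L).Adj (d4Site γ x) (d4Site γ y) ↔ (torusDiagGraph L).Adj x y := by
  refine ⟨fun h => ?_, torusDiagGraph_adj_d4Site γ⟩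
  have h' := torusDiagGraph_adj_d4Site γ⁻¹ h
  rwa [d4Site_inv_apply, d4Site_inv_apply] at h'

variable [NeZero L]

/-- The induced automorphisms of the fermion-labelled diagonal bond graph. [cite: Scalapino1995, §2] -/
theorem fermionTorusDiagGraph_adj_d4SitePerm (γ : DihedralGroup 4) (x y : FermionTorus 2 L) :
    (fermionTorusDiagGraph L).Adj (FermionTorus.ofTorusEquiv (d4SitePerm γ) x)
        (FermionTorus.ofTorusEquiv (d4SitePerm γ) y) ↔ (fermionTorusDiagGraph L).Adj x y := by
  rw [fermionTorusDiagGraph_adj, fermionTorusDiagGraph_adj, FermionTorus.toTorusSite_ofTorusEquiv,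
    FermionTorus.toTorusSite_ofTorusEquiv]
  exact torusDiagGraph_adj_d4Site_iff γ _ _

/-- **`D₄` invariance of the `t–t'` Hubbard Hamiltonian on the square torus**: `U_γ H^{tt'} U_γ⁻¹ =
H^{tt'}` (both bond graphs are `D₄`-invariant). [cite: XuEtAl2024, eq. (1)] -/
theorem relabel_d4Perm_hubbardTorusTT' (γ : DihedralGroup 4) (t t' U : ℝ) :
    relabel (Orb.d4Perm γ) (hubbardTorusTT' L t t' U) = hubbardTorusTT' L t t' U := by
  have hdiag : relabel (Orb.d4Perm γ) (hamiltonian (fermionTorusDiagGraph L) t' 0) =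
      hamiltonian (fermionTorusDiagGraph L) t' 0 := by
    rw [Orb.d4Perm_eq_mapEquiv]
    exact relabel_hamiltonian (fermionTorusDiagGraph L) (fermionTorusDiagGraph L) _
      (fermionTorusDiagGraph_adj_d4SitePerm γ) t' 0
  rw [hubbardTorusTT', relabel_add, ← hubbardTorus, relabel_d4Perm_hubbardTorus, hdiag]

/-- `[U_γ, H^{tt'}] = 0` for the `D₄` unitaries. [cite: XuEtAl2024, eq. (1)] -/
theorem fockD4_commute_hubbardTorusTT' (γ : DihedralGroup 4) (t t' U : ℝ) :
    Commute (fockD4 (L := L) γ).val (hubbardTorusTT' L t t' U) :=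
  fockRelabel_commute_of_relabel_eq _ (relabel_d4Perm_hubbardTorusTT' γ t t' U)

/-- The affine `D₄` unitary `U_w D_γ` commutes with the `t–t'` Hamiltonian of the square torus
(`x ↦ γ x + w` is a symmetry of the `t–t'` model about every site). [cite: Han2020Bootstrap, §3] -/
theorem d4Affine_mul_hubbardTorusTT' (γ : DihedralGroup 4) (w : TorusSite 2 L) (t t' U : ℝ) :
    (fockTranslate w).val * (fockD4 (L := L) γ).val * hubbardTorusTT' L t t' U =
      hubbardTorusTT' L t t' U * ((fockTranslate w).val * (fockD4 (L := L) γ).val) := by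
  rw [Matrix.mul_assoc, (fockD4_commute_hubbardTorusTT' γ t t' U).eq, ← Matrix.mul_assoc,
    (fockTranslate_commute_hubbardTorusTT' L w t t' U).eq, Matrix.mul_assoc]

end PointGroup

/-! ### The window certificate with point-group reductions for the `t–t'` torus -/

section Window

variable {L : ℕ} [NeZero L]

/-- (Local to this section, as in `HubbardWindowCertificateD4` / `HubbardNNNHoppingWindowCertificate`.)
[folklore] -/
local instance (priority := high) instDecidableEqFermionTorusTTD4 : DecidableEq (FermionTorus 2 L) :=
  LinearOrder.toDecidableEq

/-- **Window certificate with affine `D₄` reductions ⇒ energy per site of every large `t–t'` torus.**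
As `groundEnergy_hubbardTorusTT'_div_ge_of_window_certificate` (translations only), with the symmetry
family of AFFINE `D₄` maps `x ↦ γₗ x + wₗ` of `HubbardWindowCertificateD4` (translations: `γₗ = 1`):
fix a window `Λ' ⊆ ℤ²` containing `thicken {0} 1`, an inner region `Λ ⊆ Λ'` with all eight king-move
neighbours of every site of `Λ` inside `Λ'` (`thicken Λ 1 ⊆ Λ'`), regions `γₗΛ + wₗ ⊆ Λ'`, real
`μ_↑, μ_↓, ν`, and the identity in `𝔄_{Λ'}`
`Γ(incl) E^{tt'}_Φ − c·1 − Σ_σ μ_σ (n_{0σ} − ν·1) = Σ Λₐᵦ Oₐᴴ O_b + (Σₖ (H^{tt'}_{Λ'} Bₖ − Bₖ H^{tt'}_{Λ'})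
   + Σₗ (Γ(incl)(Γ(d4Emb γₗ wₗ) Yₗ) − Γ(incl) Yₗ) + Σⱼ bⱼ • wⱼ) + (Σₘ dₘ • (Vₘᴴ − Vₘ) + Σₖ aₖ • vₖ)`
(`E^{tt'}_Φ = (hubbardTTPrimeFermionInteraction t t' U).meanEnergyObs 1`, `H^{tt'}_{Λ'}` its local
Hamiltonian, `Λ ⪰ 0`, `Bₖ, Yₗ ∈ 𝔄_Λ`, charged ladder words `wⱼ`, real `dₘ`, ladder words `vₖ`).
Then for every `L ≥ 3` with `x ↦ x mod L` injective on `thicken Λ' 1` and every `n ≤ L²`: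
`c − Σₖ ‖aₖ‖ + (Σ_σ μ_σ)(n/L² − ν) ≤ groundEnergy (hubbardTorusTT' L t t' U) (2n) / L²`.
Han 2020 §2–3 (translations, `Π`, `R`, `F[[H,O]] = 0`, `F[n_x] = n`, charges) for the `t–t'` model
of Xu et al. (2024) eq. (1), read on the periodic box through the tracial sector ground state.
[cite: Han2020Bootstrap, §3] -/
theorem groundEnergy_hubbardTorusTT'_div_ge_of_window_certificate_d4 (t t' U : ℝ) (hL : 3 ≤ L)
    {nh : ℕ} (hn : nh ≤ Fintype.card (FermionTorus 2 L))
    {Λ Λ' : Finset (Site 2)} (hΛ : Λ ⊆ Λ') (h8 : thicken Λ 1 ⊆ Λ')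
    (h0 : thicken ({0} : Finset (Site 2)) 1 ⊆ Λ') (hz : (0 : Site 2) ∈ Λ')
    (hInj : Set.InjOn (Torus.proj (d := 2) L) ↑(thicken Λ' 1))
    (μ : Fin 2 → ℝ) (ν : ℝ)
    {m : Type*} [Fintype m] [DecidableEq m] {Λm : Matrix m m ℂ} (hΛm : Λm.PosSemidef)
    (O : m → FermionOp Λ')
    {κ : Type*} (s : Finset κ) (B : κ → FermionOp Λ)
    {ι : Type*} (tt : Finset ι) (γ : ι → DihedralGroup 4) (wv : ι → Site 2)
    (hsh : ∀ l, d4ShiftSet (γ l) (wv l) Λ ⊆ Λ') (Y : ι → FermionOp Λ)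
    {ρ : Type*} (u : Finset ρ) (b : ρ → ℂ) (cw : ρ → List (Orb (PolySite Λ') × Bool))
    (hcw : ∀ j ∈ u, ladderCharge (cw j) ≠ 0 ∨ ladderSpinCharge (cw j) ≠ 0)
    {δ : Type*} (ah : Finset δ) (dc : δ → ℝ) (V : δ → FermionOp Λ')
    {κ'' : Type*} (w : Finset κ'') (a : κ'' → ℂ) (word : κ'' → List (Orb (PolySite Λ') × Bool)) {c : ℝ}
    (hcert : fermionEmbed (PolySite.incl h0) ((hubbardTTPrimeFermionInteraction t t' U).meanEnergyObs 1) -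
        (c : ℂ) • (1 : FermionOp Λ') -
        ∑ σ : Fin 2, ((μ σ : ℝ) : ℂ) • (nAt 0 hz σ - ((ν : ℝ) : ℂ) • (1 : FermionOp Λ')) =
      gramForm Λm O +
        (∑ k ∈ s, ((hubbardTTPrimeFermionInteraction t t' U).localHamiltonian Λ' * fermionEmbed (PolySite.incl hΛ) (B k) -
            fermionEmbed (PolySite.incl hΛ) (B k) * (hubbardTTPrimeFermionInteraction t t' U).localHamiltonian Λ') +
          ∑ l ∈ tt, (fermionEmbed (PolySite.incl (hsh l)) (fermionEmbed (PolySite.d4Emb (γ l) (wv l) Λ) (Y l)) -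
            fermionEmbed (PolySite.incl hΛ) (Y l)) +
          ∑ j ∈ u, b j • ladderWord (cw j)) +
        (∑ m' ∈ ah, ((dc m' : ℝ) : ℂ) • ((V m')ᴴ - V m') + ∑ k ∈ w, a k • ladderWord (word k))) :
    c - ∑ k ∈ w, ‖a k‖ + (∑ σ : Fin 2, μ σ) * ((nh : ℝ) / (L : ℝ) ^ 2 - ν) ≤
      groundEnergy (hubbardTorusTT' L t t' U) (2 * nh) / (L : ℝ) ^ 2 := by
  -- the pull-back homomorphism and its restrictions
  have hInj' : Set.InjOn (Torus.proj (d := 2) L) ↑Λ' := hInj.mono (by exact_mod_cast subset_thicken Λ' 1)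
  have hInjΛ : Set.InjOn (Torus.proj (d := 2) L) ↑Λ := hInj'.mono (by exact_mod_cast hΛ)
  have hInj0 : Set.InjOn (Torus.proj (d := 2) L) ↑(thicken ({0} : Finset (Site 2)) 1) :=
    hInj'.mono (by exact_mod_cast h0)
  set Γ' := fermionEmbed (PolySite.toTorusEmb L hInj') with hΓ'
  set ΓΛ := fermionEmbed (PolySite.toTorusEmb L hInjΛ) with hΓΛ
  set H := hubbardTorusTT' L t t' U with hH
  set EΦ := (hubbardTTPrimeFermionInteraction t t' U).meanEnergyObs 1 with hEΦ
  -- the objective: `Γ' (Γ(incl) E_Φ) = Γ(ι₀) E_Φ`, whose translates sum to `H`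
  set X := Γ' (fermionEmbed (PolySite.incl h0) EΦ) with hX
  have hX0 : X = fermionEmbed (PolySite.toTorusEmb L hInj0) EΦ := fermionEmbed_toTorusEmb_incl h0 hInj' EΦ
  have hsum : ∑ v' : TorusSite 2 L, (fockTranslate v').val * X * (fockTranslate v').valᴴ = H := by
    rw [hX0]
    have h := sum_relabel_translate_hubbardTTPrime_meanEnergyObs (L := L) t' t U hL
    simp_rw [relabel_eq_fockRelabel_conj] at h
    exact h
  -- density observables
  set D : Fin 2 → Matrix (Finset (Orb (FermionTorus 2 L))) (Finset (Orb (FermionTorus 2 L))) ℂ :=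
    fun σ => numberOp (FermionTorus.ofTorusSite (0 : TorusSite 2 L)) σ with hD
  set G : Fin 2 → Matrix (Finset (Orb (FermionTorus 2 L))) (Finset (Orb (FermionTorus 2 L))) ℂ :=
    fun σ => ∑ y : FermionTorus 2 L, numberOp y σ with hG
  have hDΓ : ∀ σ, Γ' (nAt 0 hz σ) = D σ := fun σ => fermionEmbed_toTorusEmb_nAt_zero hz hInj' σ
  have hDsum : ∀ σ ∈ (Finset.univ : Finset (Fin 2)),
      ∑ v' : TorusSite 2 L, (fockTranslate v').val * D σ * (fockTranslate v').valᴴ = G σ :=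
    fun σ _ => sum_conj_fockTranslate_numberOp 0 σ
  have hGh : ∀ σ ∈ (Finset.univ : Finset (Fin 2)), (G σ).IsHermitian := fun σ _ => isHermitian_sum_numberOp σ
  have hGs : ∀ σ ∈ (Finset.univ : Finset (Fin 2)),
      ∀ ψ ∈ (szSector (2 * nh) 0 : Submodule ℂ (Fock (Orb (FermionTorus 2 L)))),
        G σ *ᵥ ψ = (((nh : ℝ) : ℝ) : ℂ) • ψ := by
    intro σ _ ψ hψ
    rw [hG, spinNumber_mulVec_of_mem_szSector σ hψ]
    congr 1
    push_cast
    ring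
  -- symmetry family: affine `D₄` maps
  set Us : ι → Matrix (Finset (Orb (FermionTorus 2 L))) (Finset (Orb (FermionTorus 2 L))) ℂ :=
    fun l => (fockTranslate (Torus.proj L (wv l))).val * (fockD4 (L := L) (γ l)).val with hUs
  set Yt : ι → Matrix (Finset (Orb (FermionTorus 2 L))) (Finset (Orb (FermionTorus 2 L))) ℂ :=
    fun l => ΓΛ (Y l) with hYt
  have hU : ∀ l ∈ tt, Us l * H = H * Us l := fun l _ => d4Affine_mul_hubbardTorusTT' _ _ t t' U
  have hUK : ∀ l ∈ tt, ∀ ψ ∈ (szSector (2 * nh) 0 : Submodule ℂ (Fock (Orb (FermionTorus 2 L)))),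
      Us l *ᵥ ψ ∈ (szSector (2 * nh) 0 : Submodule ℂ (Fock (Orb (FermionTorus 2 L)))) :=
    fun l _ ψ hψ => d4Affine_mulVec_mem_szSector _ _ hψ
  have hUK' : ∀ l ∈ tt, ∀ ψ ∈ (szSector (2 * nh) 0 : Submodule ℂ (Fock (Orb (FermionTorus 2 L)))),
      (Us l)ᴴ *ᵥ ψ ∈ (szSector (2 * nh) 0 : Submodule ℂ (Fock (Orb (FermionTorus 2 L)))) :=
    fun l _ ψ hψ => d4Affine_conjTranspose_mulVec_mem_szSector _ _ hψ
  have hUU : ∀ l ∈ tt, (Us l)ᴴ * Us l = 1 := fun l _ => d4Affine_conjTranspose_mul_self _ _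
  -- charge family (charged words as commutators with `N̂` / `S^z`)
  set emb : Orb (PolySite Λ') × Bool → Orb (FermionTorus 2 L) × Bool :=
    fun p => (Orb.embMap (PolySite.toTorusEmb L hInj') p.1, p.2) with hemb
  set C : ρ → Matrix (Finset (Orb (FermionTorus 2 L))) (Finset (Orb (FermionTorus 2 L))) ℂ :=
    fun j => if ladderCharge ((cw j).map emb) ≠ 0 then totalNumber else HubbardWave0.spinZ with hC
  set W : ρ → Matrix (Finset (Orb (FermionTorus 2 L))) (Finset (Orb (FermionTorus 2 L))) ℂ :=
    fun j => (b j / (if ladderCharge ((cw j).map emb) ≠ 0 then ((ladderCharge ((cw j).map emb) : ℤ) : ℂ)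
      else ((ladderSpinCharge ((cw j).map emb) : ℤ) : ℂ) / 2)) • ladderWord ((cw j).map emb) with hW
  have hHN : Commute H totalNumber := hubbardTorusTT'_commute_totalNumber L t t' U
  have hHS : Commute H HubbardWave0.spinZ := hubbardTorusTT'_commute_spinZ L t t' U
  have hC1 : ∀ j ∈ u, C j * H = H * C j := by
    intro j _
    by_cases hq : ladderCharge ((cw j).map emb) ≠ 0
    · simp only [hC, hq, ne_eq, not_false_eq_true, if_true]; exact hHN.symm.eq
    · simp only [hC, hq, if_false]; exact hHS.symm.eq
  have hCK : ∀ j ∈ u, ∀ ψ ∈ (szSector (2 * nh) 0 : Submodule ℂ (Fock (Orb (FermionTorus 2 L)))),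
      C j *ᵥ ψ ∈ (szSector (2 * nh) 0 : Submodule ℂ (Fock (Orb (FermionTorus 2 L)))) := by
    intro j _ ψ hψ
    obtain ⟨hNψ, hSψ⟩ := (mem_szSector_iff _ _ ψ).1 hψ
    by_cases hq : ladderCharge ((cw j).map emb) ≠ 0
    · simp only [hC, hq, ne_eq, not_false_eq_true, if_true]
      rw [totalNumber_mulVec_of_isNParticle hNψ]
      exact Submodule.smul_mem _ _ hψ
    · simp only [hC, hq, if_false]
      rw [hSψ]
      exact Submodule.smul_mem _ _ hψ
  have hCh : ∀ j, (C j)ᴴ = C j := by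
    intro j
    by_cases hq : ladderCharge ((cw j).map emb) ≠ 0
    · simp only [hC, hq, ne_eq, not_false_eq_true, if_true]
      rw [totalNumber_eq_numberDiag_univ]
      exact numberDiag_conjTranspose _
    · simp only [hC, hq, if_false]; exact HubbardWave0.spinZ_isHermitian.eq
  have hCK' : ∀ j ∈ u, ∀ ψ ∈ (szSector (2 * nh) 0 : Submodule ℂ (Fock (Orb (FermionTorus 2 L)))),
      (C j)ᴴ *ᵥ ψ ∈ (szSector (2 * nh) 0 : Submodule ℂ (Fock (Orb (FermionTorus 2 L)))) :=
    fun j hj ψ hψ => by rw [hCh j]; exact hCK j hj ψ hψ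
  have hcharged : ∀ j ∈ u, Γ' (b j • ladderWord (cw j)) = C j * W j - W j * C j := by
    intro j hj
    rw [map_smul, hΓ', fermionEmbed_ladderWord]
    have hl : ladderCharge ((cw j).map emb) ≠ 0 ∨ ladderSpinCharge ((cw j).map emb) ≠ 0 := by
      rw [hemb, ladderCharge_map_embMap, ladderSpinCharge_map_embMap]; exact hcw j hj
    exact smul_ladderWord_eq_commutator_of_charged (b j) _ hl
  -- residual words
  set Mw : κ'' → Matrix (Finset (Orb (FermionTorus 2 L))) (Finset (Orb (FermionTorus 2 L))) ℂ :=
    fun k => ladderWord ((word k).map emb) with hMw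
  have hMc : ∀ k ∈ w, (Mw k).IsContraction := fun k _ => by
    rw [hMw]; dsimp only; rw [ladderWord_eq_prod]; exact isContraction_prod_ladder _
  -- the identity, pulled back into the torus
  have htorus : X - (c : ℂ) • (1 : Matrix (Finset (Orb (FermionTorus 2 L))) (Finset (Orb (FermionTorus 2 L))) ℂ) -
      ∑ σ ∈ (Finset.univ : Finset (Fin 2)), ((μ σ : ℝ) : ℂ) • (D σ - ((ν : ℝ) : ℂ) •
        (1 : Matrix (Finset (Orb (FermionTorus 2 L))) (Finset (Orb (FermionTorus 2 L))) ℂ)) =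
      gramForm Λm (fun i => Γ' (O i)) +
        (∑ k ∈ s, (H * Γ' (fermionEmbed (PolySite.incl hΛ) (B k)) - Γ' (fermionEmbed (PolySite.incl hΛ) (B k)) * H) +
          ∑ l ∈ tt, (Us l * Yt l * (Us l)ᴴ - Yt l) +
          ∑ i ∈ (∅ : Finset (Fin 0)), ((0 : Matrix _ _ ℂ) * ((0 : Matrix _ _ ℂ) - (((0 : ℝ) : ℝ) : ℂ) • 1) +
            ((0 : Matrix _ _ ℂ) - (((0 : ℝ) : ℝ) : ℂ) • 1) * (0 : Matrix _ _ ℂ)) +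
          ∑ j ∈ u, (C j * W j - W j * C j)) +
        (∑ m' ∈ ah, ((dc m' : ℝ) : ℂ) • ((Γ' (V m'))ᴴ - Γ' (V m')) + ∑ k ∈ w, a k • Mw k) := by
    have key := congrArg Γ' hcert
    -- left-hand side
    rw [map_sub, map_sub, map_smul, map_one, map_sum] at key
    have hlhs : ∑ σ : Fin 2, Γ' (((μ σ : ℝ) : ℂ) • (nAt 0 hz σ - ((ν : ℝ) : ℂ) • (1 : FermionOp Λ'))) =
        ∑ σ ∈ (Finset.univ : Finset (Fin 2)), ((μ σ : ℝ) : ℂ) • (D σ - ((ν : ℝ) : ℂ) •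
          (1 : Matrix (Finset (Orb (FermionTorus 2 L))) (Finset (Orb (FermionTorus 2 L))) ℂ)) :=
      Finset.sum_congr rfl fun σ _ => by rw [map_smul, map_sub, map_smul, map_one, hDΓ]
    rw [hlhs] at key
    -- right-hand side, family by family
    have h1 : Γ' (∑ k ∈ s, ((hubbardTTPrimeFermionInteraction t t' U).localHamiltonian Λ' * fermionEmbed (PolySite.incl hΛ) (B k) -
        fermionEmbed (PolySite.incl hΛ) (B k) * (hubbardTTPrimeFermionInteraction t t' U).localHamiltonian Λ')) =
        ∑ k ∈ s, (H * Γ' (fermionEmbed (PolySite.incl hΛ) (B k)) - Γ' (fermionEmbed (PolySite.incl hΛ) (B k)) * H) := by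
      rw [map_sum]
      refine Finset.sum_congr rfl fun k _ => ?_
      rw [hH, hΓ', hubbardTorusTT'_commutator_fermionEmbed L t t' U hΛ h8 hInj (B k)]
    have h2 : Γ' (∑ l ∈ tt, (fermionEmbed (PolySite.incl (hsh l)) (fermionEmbed (PolySite.d4Emb (γ l) (wv l) Λ) (Y l)) -
        fermionEmbed (PolySite.incl hΛ) (Y l))) = ∑ l ∈ tt, (Us l * Yt l * (Us l)ᴴ - Yt l) := by
      rw [map_sum]
      refine Finset.sum_congr rfl fun l _ => ?_
      rw [hUs, hYt, hΓΛ, hΓ']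
      exact fermionEmbed_toTorusEmb_d4_sub hΛ (γ l) (wv l) (hsh l) hInj' (Y l)
    have h3 : Γ' (∑ j ∈ u, b j • ladderWord (cw j)) = ∑ j ∈ u, (C j * W j - W j * C j) := by
      rw [map_sum]
      exact Finset.sum_congr rfl hcharged
    have h4 : Γ' (∑ m' ∈ ah, ((dc m' : ℝ) : ℂ) • ((V m')ᴴ - V m')) =
        ∑ m' ∈ ah, ((dc m' : ℝ) : ℂ) • ((Γ' (V m'))ᴴ - Γ' (V m')) := by
      rw [map_sum]
      refine Finset.sum_congr rfl fun m' _ => ?_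
      rw [map_smul, map_sub, hΓ', fermionEmbed_conjTranspose]
    have h5 : Γ' (∑ k ∈ w, a k • ladderWord (word k)) = ∑ k ∈ w, a k • Mw k := by
      rw [map_sum]
      refine Finset.sum_congr rfl fun k _ => ?_
      rw [map_smul, hMw, hΓ', fermionEmbed_ladderWord]
    rw [hX, key, map_add, map_add, map_add, map_add, map_add, hΓ', fermionEmbed_gramForm, ← hΓ', h1, h2, h3, h4, h5,
      Finset.sum_empty, add_zero]
  -- apply the generic torus theorem
  have hA : H.IsHermitian := hubbardTorusTT'_isHermitian L t t' U
  have hKA : ∀ ψ ∈ (szSector (2 * nh) 0 : Submodule ℂ (Fock (Orb (FermionTorus 2 L)))),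
      H *ᵥ ψ ∈ (szSector (2 * nh) 0 : Submodule ℂ (Fock (Orb (FermionTorus 2 L)))) :=
    fun ψ hψ => mulVec_hubbardTorusTT'_mem_szSector L t t' U hψ
  have hAT : ∀ v' : TorusSite 2 L, (fockTranslate v').val * H = H * (fockTranslate v').val := fun v' =>
    (fockTranslate_commute_hubbardTorusTT' L v' t t' U).eq
  have hmain := torus_minEnergyOn_div_ge_of_local_certificate H hA hn hKA hAT X hsum
    (Finset.univ : Finset (Fin 2)) μ (fun _ => ν) (fun _ => (nh : ℝ)) D G hDsum hGh hGs hΛm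
    (fun i => Γ' (O i)) s (fun k => Γ' (fermionEmbed (PolySite.incl hΛ) (B k))) tt Us Yt hU hUK hUK' hUU
    (∅ : Finset (Fin 0)) (fun _ => 0) (fun _ => 0) (fun _ => 0) (fun _ => 0)
    (fun i hi => absurd hi (Finset.notMem_empty i)) (fun i hi => absurd hi (Finset.notMem_empty i))
    u C W hC1 hCK hCK' ah dc (fun m' => Γ' (V m')) w a Mw hMc htorus
  have hs : ∑ σ ∈ (Finset.univ : Finset (Fin 2)), μ σ * ((nh : ℝ) / (L : ℝ) ^ 2 - ν) =
      (∑ σ : Fin 2, μ σ) * ((nh : ℝ) / (L : ℝ) ^ 2 - ν) := by rw [Finset.sum_mul]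
  rw [hs, ← groundEnergy_hubbardTorusTT'_eq_minEnergyOn_szSector L t t' U hn] at hmain
  exact hmain

/-! ### Thermodynamic limit -/

/-- **Window certificate with affine `D₄` reductions ⇒ thermodynamic-limit energy density of the
`t–t'` Hubbard model.** With the data of `groundEnergy_hubbardTorusTT'_div_ge_of_window_certificate_d4`
and target density `n ∈ [0, 2)` (density constraints `n_{0σ} − (n/2)·1`, `U ≥ 0`), the window identity
proves `c − Σₖ ‖aₖ‖ ≤ energyDensityTT' t t' U n` (eventual injectivity of `x ↦ x mod L` on the
window, `exists_forall_le_injOn_proj`; limit by `energyDensityTT'_ge_of_eventually_ge_torus`). This is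
the soundness statement for Han's thermodynamic-limit bootstrap with its FULL square-lattice
constraint set (positivity, `F[[H,O]] = 0`, `U(1)×U(1)` charges, translations, `Π`, `R`, density)
applied to the `t–t'` model of Xu et al. (2024) eq. (1) — the hypothesis list of
`energyDensity2D_ge_of_window_certificate_d4` with `hubbardTTPrimeFermionInteraction t t' U` and the
king-move thickening `thicken Λ 1 ⊆ Λ'`. [cite: Han2020Bootstrap, §3] -/
theorem energyDensityTT'_ge_of_window_certificate_d4 (t t' : ℝ) {U : ℝ} (hU : 0 ≤ U) {n : ℝ}
    (hn0 : 0 ≤ n) (hn2 : n < 2)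
    {Λ Λ' : Finset (Site 2)} (hΛ : Λ ⊆ Λ') (h8 : thicken Λ 1 ⊆ Λ')
    (h0 : thicken ({0} : Finset (Site 2)) 1 ⊆ Λ') (hz : (0 : Site 2) ∈ Λ')
    (μ : Fin 2 → ℝ)
    {m : Type*} [Fintype m] [DecidableEq m] {Λm : Matrix m m ℂ} (hΛm : Λm.PosSemidef)
    (O : m → FermionOp Λ')
    {κ : Type*} (s : Finset κ) (B : κ → FermionOp Λ)
    {ι : Type*} (tt : Finset ι) (γ : ι → DihedralGroup 4) (wv : ι → Site 2)
    (hsh : ∀ l, d4ShiftSet (γ l) (wv l) Λ ⊆ Λ') (Y : ι → FermionOp Λ)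
    {ρ : Type*} (u : Finset ρ) (b : ρ → ℂ) (cw : ρ → List (Orb (PolySite Λ') × Bool))
    (hcw : ∀ j ∈ u, ladderCharge (cw j) ≠ 0 ∨ ladderSpinCharge (cw j) ≠ 0)
    {δ : Type*} (ah : Finset δ) (dc : δ → ℝ) (V : δ → FermionOp Λ')
    {κ'' : Type*} (w : Finset κ'') (a : κ'' → ℂ) (word : κ'' → List (Orb (PolySite Λ') × Bool)) {c : ℝ}
    (hcert : fermionEmbed (PolySite.incl h0) ((hubbardTTPrimeFermionInteraction t t' U).meanEnergyObs 1) -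
        (c : ℂ) • (1 : FermionOp Λ') -
        ∑ σ : Fin 2, ((μ σ : ℝ) : ℂ) • (nAt 0 hz σ - ((n / 2 : ℝ) : ℂ) • (1 : FermionOp Λ')) =
      gramForm Λm O +
        (∑ k ∈ s, ((hubbardTTPrimeFermionInteraction t t' U).localHamiltonian Λ' * fermionEmbed (PolySite.incl hΛ) (B k) -
            fermionEmbed (PolySite.incl hΛ) (B k) * (hubbardTTPrimeFermionInteraction t t' U).localHamiltonian Λ') +
          ∑ l ∈ tt, (fermionEmbed (PolySite.incl (hsh l)) (fermionEmbed (PolySite.d4Emb (γ l) (wv l) Λ) (Y l)) -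
            fermionEmbed (PolySite.incl hΛ) (Y l)) +
          ∑ j ∈ u, b j • ladderWord (cw j)) +
        (∑ m' ∈ ah, ((dc m' : ℝ) : ℂ) • ((V m')ᴴ - V m') + ∑ k ∈ w, a k • ladderWord (word k))) :
    c - ∑ k ∈ w, ‖a k‖ ≤ ThermodynamicLimit.energyDensityTT' t t' U n := by
  obtain ⟨L₀, hL₀⟩ := exists_forall_le_injOn_proj (thicken Λ' 1)
  refine ThermodynamicLimit.energyDensityTT'_ge_of_eventually_ge_torus t t' hU hn0 hn2
    (μ := (∑ σ : Fin 2, μ σ) / 2) ?_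
  filter_upwards [Filter.eventually_ge_atTop (max L₀ 3)] with L hL
  have hL3 : 3 ≤ L := le_trans (le_max_right _ _) hL
  have hLL : L₀ ≤ L := le_trans (le_max_left _ _) hL
  haveI : NeZero L := ⟨by omega⟩
  set nh : ℕ := ⌊n * (L : ℝ) ^ 2 / 2⌋₊ with hnh
  have hrect : ThermodynamicLimit.rectN n L = 2 * nh := rfl
  have hn : nh ≤ Fintype.card (FermionTorus 2 L) := by
    have h := ThermodynamicLimit.rectN_le_two_mul hn0 hn2.le L
    rw [hrect] at h
    have hcard : Fintype.card (FermionTorus 2 L) = L ^ 2 := by simp [FermionTorus]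
    rw [hcard, sq]
    omega
  have hmain := groundEnergy_hubbardTorusTT'_div_ge_of_window_certificate_d4 t t' U hL3 hn hΛ h8 h0 hz (hL₀ L hLL)
    μ (n / 2) hΛm O s B tt γ wv hsh Y u b cw hcw ah dc V w a word hcert
  have key : c - ∑ k ∈ w, ‖a k‖ + (∑ σ : Fin 2, μ σ) / 2 * ((((2 * nh : ℕ) : ℝ)) / (L : ℝ) ^ 2 - n) =
      c - ∑ k ∈ w, ‖a k‖ + (∑ σ : Fin 2, μ σ) * ((nh : ℝ) / (L : ℝ) ^ 2 - n / 2) := by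
    push_cast
    ring
  rw [hrect, key]
  exact hmain

end Window

end Literature.MathematicalPhysics.QuantumLattice

end
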